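import Mathlib
import HarnessLib
import Summits.HubbardSuperconductivity.HubbardSuperconductivity.Theorems.KLProgrammeKLRegimeVolumeLimitPerSite
import Summits.HubbardSuperconductivity.HubbardSuperconductivity.Theorems.KLProgrammeKLRegimeTwoPointAssemblyIteratedTannery

/-!
# VL children from PER-SITE, PER-LABEL data, II: the doors — «termwise limits» (BGM 2006 Lemma 2.4's own currency) close the child
# (seat hubbard-kl-k3c5-p3 g7, technique «OS-positivity-free direct assembly»; `--supports` the VL child stmt-HubbardSuperconductivity-20239)

Sequel of …VolumeLimitPerSite (`nestedInf_eps_of_perSite_eps`: per-site `ε`-comparability of the site kernel `torusFourierInv (Σ∞⁰_L(n,·)) (Torus.proj L z)`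
⇒ per-label nested same-momentum `ε`-comparability of the cutoff-free carrier).  Here the cutoff is put back (this seat's label-uniform cutoff removal
`klSelfEnergy_cutoffLimit_labelUniform`, p490877) and everything is threaded through `volumeLimitP2_of_perLabelThresholdsOnlyText` (p512141):

* §1 `perLabelText_of_nestedInf_eps` — cutoff-free per-label `ε`-comparability ⇒ the finite-cutoff per-label-thresholds text (diagonal rate + cutoff removal
  at both volumes); `perSite_eps_of_perSite_rate`, `perSite_eps_of_perSite_limit`, `perSite_limit_of_perSite_cutoffLimit` (finite-cutoff iterated per-site
  limits `lim_L lim_M` ⇒ cutoff-free per-site limits, through the averaging `torusFourierInv`), `perSite_limit_of_termwise` (Tannery).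
* §2 DOORS for every bundle `Pr` and window `W` (at `klPredsV16`/`klWindowC` they close stmt-…-20239 through `klPredsV16_frameOK_imp`):
  `volumeLimitP2_of_perLabelInfEpsText` (cutoff-free per-label momentum form, no rate function),
  **`volumeLimitP2_of_perSiteEpsText`** (per-site nested `ε`-comparability), `volumeLimitP2_of_perSiteText` (per-site rates),
  **`volumeLimitP2_of_perSiteLimitText`** (per-site PLAIN LIMITS — BGM Lemma 2.4 verbatim: for each `n` and `z` the number `h_L(n,z)` converges),
  **`volumeLimitP2_of_perSiteCutoffLimitText`** (per-site iterated finite-cutoff limits — the engine's own variables),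
  `volumeLimitP2_of_perSiteTermwiseText` (per-site TERMWISE expansions with a uniform summable majorant — Lemma 2.4's proof shape).

WHAT THE ENGINE LINEAGE THEN OWES FOR THE VL CHILD: for each Matsubara integer `n` and each lattice offset `z ∈ ℤ²`, convergence (or nested Cauchy-ness)
of ONE complex sequence — no norm, no uniformity in `n`, `z`, momentum or cutoff, no modulus, no rate, no periodisation.  Everything is proved; no
definition; nothing is asserted about the model.
-/

noncomputable section

namespace Summit.HubbardSuperconductivity.HubbardSuperconductivity.Theorems.TwoPointAssembly

set_option linter.dupNamespace false -- summit = problem name (single-conjunct summit), D-0017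

open scoped ComplexConjugate
open Finset Filter Topology Literature.MathematicalPhysics.QuantumLattice Literature.Probability.LatticeModels
open Literature.MathematicalPhysics.QuantumLattice.FermiRG
open Summit.HubbardSuperconductivity.HubbardSuperconductivity.Theorems.DispersionFlow
open Summit.HubbardSuperconductivity.HubbardSuperconductivity.Theorems.KLRegimeSplit
open Summit.HubbardSuperconductivity.HubbardSuperconductivity.Theorems.KLProgrammeLegKernels

/-! ## §1 Cutoff bookkeeping and the per-site conversions -/

section PerSite

variable {β U : ℝ}

/-- **Cutoff-free per-label ε-comparability ⇒ the finite-cutoff per-label-thresholds text** (one Matsubara integer `n`; every real `U ≠ 0`, `β > 0`).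
From nested same-momentum `ε`-comparability of `klSelfEnergyInf L β U μ 0 n` beyond `L₁(ε)` one gets a threshold (`L₀ = 3`) and a null rate `ρ` for the
FINITE-cutoff carrier `klSelfEnergy L M β U μ 0 klE0 (nScales β + 1) (ω,k) 0` at the labels `ω` with `matsubaraInt M ω = n`, eventually in `M`:
the diagonal rate `exists_rate_of_forall_eps` (…PerSite §1) plus this seat's label-uniform cutoff removal at both volumes (tolerance `1/(L+1)`). -/
theorem perLabelText_of_nestedInf_eps (hβ : 0 < β) (hU : U ≠ 0) (μ : ℝ) (n : ℤ)
    (h : ∀ ε > (0 : ℝ), ∃ L₁ : ℕ, ∀ (L : ℕ) [NeZero L], L₁ ≤ L → ∀ (L'' : ℕ) [NeZero L''], L ∣ L'' →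
      ∀ (k : TorusSite 2 L) (k'' : TorusSite 2 L''), latticeMomentum L'' k'' = latticeMomentum L k →
        ‖klSelfEnergyInf L β U μ 0 n k - klSelfEnergyInf L'' β U μ 0 n k''‖ ≤ ε) :
    ∃ L₀ : ℕ, ∃ ρ : ℕ → ℝ, Tendsto ρ atTop (𝓝 0) ∧
      ∀ (L : ℕ) [NeZero L], L₀ ≤ L → ∀ (L'' : ℕ) [NeZero L''], L ∣ L'' → ∃ M₀ : ℕ, ∀ (M : ℕ) [NeZero M], M₀ ≤ M →
        ∀ (ω : MatsubaraIdx M), matsubaraInt M ω = n → ∀ (k : TorusSite 2 L) (k'' : TorusSite 2 L''),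
          latticeMomentum L'' k'' = latticeMomentum L k →
            ‖klSelfEnergy L M β U μ 0 klE0 (nScales β + 1) (ω, k) 0 -
                klSelfEnergy L'' M β U μ 0 klE0 (nScales β + 1) (ω, k'') 0‖ ≤ ρ L := by
  -- the cutoff-free property, guarded by `3 ≤ L`
  set P : ℕ → ℝ → Prop := fun L ε => ∀ [NeZero L], 3 ≤ L → ∀ (L'' : ℕ) [NeZero L''], L ∣ L'' →
    ∀ (k : TorusSite 2 L) (k'' : TorusSite 2 L''), latticeMomentum L'' k'' = latticeMomentum L k →
      ‖klSelfEnergyInf L β U μ 0 n k - klSelfEnergyInf L'' β U μ 0 n k''‖ ≤ ε with hP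
  set Bc : ℝ := 3 / 2 * |U| + 9 / 4 * β * U ^ 2 with hBc
  have hB : ∀ L, P L (2 * Bc) := by
    intro L _ hL3 L'' _ hdvd k k'' _
    have hL3'' : 3 ≤ L'' := hL3.trans (Nat.le_of_dvd (Nat.pos_of_ne_zero (NeZero.ne L'')) hdvd)
    calc ‖klSelfEnergyInf L β U μ 0 n k - klSelfEnergyInf L'' β U μ 0 n k''‖
        ≤ ‖klSelfEnergyInf L β U μ 0 n k‖ + ‖klSelfEnergyInf L'' β U μ 0 n k''‖ := norm_sub_le _ _
      _ ≤ Bc + Bc := add_le_add (norm_klSelfEnergyInf_zero_le hL3 hβ hU μ n k) (norm_klSelfEnergyInf_zero_le hL3'' hβ hU μ n k'')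
      _ = 2 * Bc := by ring
  have hev : ∀ ε > (0 : ℝ), ∃ L₁ : ℕ, ∀ L, L₁ ≤ L → P L ε := by
    intro ε hε
    obtain ⟨L₁, hL₁⟩ := h ε hε
    exact ⟨L₁, fun L hL _ _ L'' _ hdvd k k'' hkk => hL₁ L hL L'' hdvd k k'' hkk⟩
  obtain ⟨ρ₁, hρ₁, hPρ⟩ := exists_rate_of_forall_eps hB hev
  have h2 : Tendsto (fun L : ℕ => 2 * (1 / ((L : ℝ) + 1))) atTop (𝓝 0) := by
    simpa using (tendsto_one_div_add_atTop_nhds_zero_nat).const_mul (2 : ℝ)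
  refine ⟨3, fun L => ρ₁ L + 2 * (1 / ((L : ℝ) + 1)), by simpa using hρ₁.add h2, fun L _ hL L'' _ hdvd => ?_⟩
  have hL3'' : 3 ≤ L'' := hL.trans (Nat.le_of_dvd (Nat.pos_of_ne_zero (NeZero.ne L'')) hdvd)
  have hη : (0 : ℝ) < 1 / ((L : ℝ) + 1) := by positivity
  obtain ⟨M₁, hM₁⟩ := klSelfEnergy_cutoffLimit_labelUniform hL hβ U μ 0 hη
  obtain ⟨M₁'', hM₁''⟩ := klSelfEnergy_cutoffLimit_labelUniform hL3'' hβ U μ 0 hη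
  refine ⟨max M₁ M₁'', fun M _ hM ω hω k k'' hkk => ?_⟩
  have hinf : ‖klSelfEnergyInf L β U μ 0 n k - klSelfEnergyInf L'' β U μ 0 n k''‖ ≤ ρ₁ L := hPρ L hL L'' hdvd k k'' hkk
  have hc1 := hM₁ M (le_of_max_le_left hM) ω k 0
  have hc2 := hM₁'' M (le_of_max_le_right hM) ω k'' 0
  rw [hω] at hc1 hc2
  calc ‖klSelfEnergy L M β U μ 0 klE0 (nScales β + 1) (ω, k) 0 - klSelfEnergy L'' M β U μ 0 klE0 (nScales β + 1) (ω, k'') 0‖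
      ≤ ‖klSelfEnergy L M β U μ 0 klE0 (nScales β + 1) (ω, k) 0 - klSelfEnergyInf L β U μ 0 n k‖ +
          ‖klSelfEnergyInf L β U μ 0 n k - klSelfEnergyInf L'' β U μ 0 n k''‖ +
          ‖klSelfEnergyInf L'' β U μ 0 n k'' - klSelfEnergy L'' M β U μ 0 klE0 (nScales β + 1) (ω, k'') 0‖ := by
        refine (norm_sub_le_norm_sub_add_norm_sub _ (klSelfEnergyInf L β U μ 0 n k) _).trans ?_
        have := norm_sub_le_norm_sub_add_norm_sub (klSelfEnergyInf L β U μ 0 n k) (klSelfEnergyInf L'' β U μ 0 n k'')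
          (klSelfEnergy L'' M β U μ 0 klE0 (nScales β + 1) (ω, k'') 0)
        linarith
    _ ≤ 1 / ((L : ℝ) + 1) + ρ₁ L + 1 / ((L : ℝ) + 1) :=
        add_le_add (add_le_add hc1 hinf) (by rw [norm_sub_rev]; exact hc2)
    _ = ρ₁ L + 2 * (1 / ((L : ℝ) + 1)) := by ring

/-- Per-site nested RATES (`∃ L₀ ρ, ρ → 0, …`) ⇒ per-site ε-comparability (trivial direction, recorded for the rate-shaped export). [folklore] -/
theorem perSite_eps_of_perSite_rate (μ : ℝ) (n : ℤ) (z : Site 2)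
    (h : ∃ L₀ : ℕ, ∃ ρ : ℕ → ℝ, Tendsto ρ atTop (𝓝 0) ∧ ∀ (L : ℕ) [NeZero L], L₀ ≤ L → ∀ (L'' : ℕ) [NeZero L''], L ∣ L'' →
      ‖torusFourierInv (fun p : TorusSite 2 L => klSelfEnergyInf L β U μ 0 n p) (Torus.proj L z) -
        torusFourierInv (fun p : TorusSite 2 L'' => klSelfEnergyInf L'' β U μ 0 n p) (Torus.proj L'' z)‖ ≤ ρ L) :
    ∀ ε > (0 : ℝ), ∃ L₁ : ℕ, ∀ (L : ℕ) [NeZero L], L₁ ≤ L → ∀ (L'' : ℕ) [NeZero L''], L ∣ L'' →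
      ‖torusFourierInv (fun p : TorusSite 2 L => klSelfEnergyInf L β U μ 0 n p) (Torus.proj L z) -
        torusFourierInv (fun p : TorusSite 2 L'' => klSelfEnergyInf L'' β U μ 0 n p) (Torus.proj L'' z)‖ ≤ ε := by
  intro ε hε
  obtain ⟨L₀, ρ, hρ, hL₀⟩ := h
  obtain ⟨L₂, hL₂⟩ := Metric.tendsto_atTop.1 hρ ε hε
  refine ⟨max L₀ L₂, fun L _ hL L'' _ hdvd => (hL₀ L ((le_max_left _ _).trans hL) L'' hdvd).trans ?_⟩
  have := hL₂ L ((le_max_right _ _).trans hL)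
  rw [Real.dist_eq, sub_zero] at this
  exact (le_abs_self _).trans this.le

/-- Per-site plain LIMITS (ε-form: `∃ h, ∀ ε, ∃ L₁, ∀ L ≥ L₁, ‖h_L(n,z) − h‖ ≤ ε`) ⇒ per-site nested ε-comparability. [folklore] -/
theorem perSite_eps_of_perSite_limit (μ : ℝ) (n : ℤ) (z : Site 2)
    (h : ∃ hlim : ℂ, ∀ ε > (0 : ℝ), ∃ L₁ : ℕ, ∀ (L : ℕ) [NeZero L], L₁ ≤ L →
      ‖torusFourierInv (fun p : TorusSite 2 L => klSelfEnergyInf L β U μ 0 n p) (Torus.proj L z) - hlim‖ ≤ ε) :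
    ∀ ε > (0 : ℝ), ∃ L₁ : ℕ, ∀ (L : ℕ) [NeZero L], L₁ ≤ L → ∀ (L'' : ℕ) [NeZero L''], L ∣ L'' →
      ‖torusFourierInv (fun p : TorusSite 2 L => klSelfEnergyInf L β U μ 0 n p) (Torus.proj L z) -
        torusFourierInv (fun p : TorusSite 2 L'' => klSelfEnergyInf L'' β U μ 0 n p) (Torus.proj L'' z)‖ ≤ ε := by
  intro ε hε
  obtain ⟨hlim, hl⟩ := h
  obtain ⟨L₁, hL₁⟩ := hl (ε / 2) (by positivity)
  refine ⟨L₁, fun L _ hL L'' _ hdvd => ?_⟩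
  have hLL'' : L ≤ L'' := Nat.le_of_dvd (Nat.pos_of_ne_zero (NeZero.ne L'')) hdvd
  have h1 := hL₁ L hL
  have h2 := hL₁ L'' (hL.trans hLL'')
  calc ‖torusFourierInv (fun p : TorusSite 2 L => klSelfEnergyInf L β U μ 0 n p) (Torus.proj L z) -
        torusFourierInv (fun p : TorusSite 2 L'' => klSelfEnergyInf L'' β U μ 0 n p) (Torus.proj L'' z)‖
      ≤ ‖torusFourierInv (fun p : TorusSite 2 L => klSelfEnergyInf L β U μ 0 n p) (Torus.proj L z) - hlim‖ +
          ‖hlim - torusFourierInv (fun p : TorusSite 2 L'' => klSelfEnergyInf L'' β U μ 0 n p) (Torus.proj L'' z)‖ :=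
        norm_sub_le_norm_sub_add_norm_sub _ _ _
    _ ≤ ε / 2 + ε / 2 := add_le_add h1 (by rw [norm_sub_rev]; exact h2)
    _ = ε := by ring

/-- **Finite-cutoff iterated per-site limits ⇒ cutoff-free per-site limits.**  If for the offset `z` and the Matsubara integer `n` the site kernel of the
FINITE-cutoff carrier `Σ̂⁰_{L,M}(ω,·)` at the labels `matsubaraInt M ω = n` has an iterated limit `lim_L lim_M = h` (ε-form), then the site kernel of the
cutoff-free carrier `Σ∞⁰_L(n,·)` tends to the same `h` (this seat's label-uniform cutoff removal passes through the averaging `torusFourierInv`). -/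
theorem perSite_limit_of_perSite_cutoffLimit (hβ : 0 < β) (μ : ℝ) (n : ℤ) (z : Site 2)
    (h : ∃ hlim : ℂ, ∀ ε > (0 : ℝ), ∃ L₁ : ℕ, ∀ (L : ℕ) [NeZero L], L₁ ≤ L → ∃ M₁ : ℕ, ∀ (M : ℕ) [NeZero M], M₁ ≤ M →
      ∀ ω : MatsubaraIdx M, matsubaraInt M ω = n →
        ‖torusFourierInv (fun p : TorusSite 2 L => klSelfEnergy L M β U μ 0 klE0 (nScales β + 1) (ω, p) 0) (Torus.proj L z) - hlim‖ ≤ ε) :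
    ∃ hlim : ℂ, ∀ ε > (0 : ℝ), ∃ L₁ : ℕ, ∀ (L : ℕ) [NeZero L], L₁ ≤ L →
      ‖torusFourierInv (fun p : TorusSite 2 L => klSelfEnergyInf L β U μ 0 n p) (Torus.proj L z) - hlim‖ ≤ ε := by
  obtain ⟨hlim, hl⟩ := h
  refine ⟨hlim, fun ε hε => ?_⟩
  obtain ⟨L₁, hL₁⟩ := hl (ε / 2) (by positivity)
  refine ⟨max L₁ 3, fun L _ hL => ?_⟩
  have hL3 : 3 ≤ L := (le_max_right _ _).trans hL
  obtain ⟨M₁, hM₁⟩ := hL₁ L ((le_max_left _ _).trans hL)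
  obtain ⟨M₂, hM₂⟩ := klSelfEnergy_cutoffLimit_labelUniform hL3 hβ U μ 0 (show (0 : ℝ) < ε / 2 by positivity)
  set M : ℕ := max (max M₁ M₂) (n.natAbs + 1) with hM
  have hMn : n.natAbs + 1 ≤ M := le_max_right _ _
  haveI : NeZero M := ⟨by omega⟩
  obtain ⟨ω, hω⟩ := exists_matsubaraInt_eq (M := M) (n := n) (by rw [Finset.mem_Ico]; omega)
  have hfin := hM₁ M ((le_max_left _ _).trans (le_max_left _ _)) ω hω
  have hcut : ‖torusFourierInv (fun p : TorusSite 2 L => klSelfEnergyInf L β U μ 0 n p) (Torus.proj L z) -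
      torusFourierInv (fun p : TorusSite 2 L => klSelfEnergy L M β U μ 0 klE0 (nScales β + 1) (ω, p) 0) (Torus.proj L z)‖ ≤ ε / 2 := by
    refine norm_torusFourierInv_sub_le (fun p => ?_) _
    rw [norm_sub_rev, ← hω]
    exact hM₂ M ((le_max_right _ _).trans (le_max_left _ _)) ω p 0
  calc ‖torusFourierInv (fun p : TorusSite 2 L => klSelfEnergyInf L β U μ 0 n p) (Torus.proj L z) - hlim‖
      ≤ ‖torusFourierInv (fun p : TorusSite 2 L => klSelfEnergyInf L β U μ 0 n p) (Torus.proj L z) -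
            torusFourierInv (fun p : TorusSite 2 L => klSelfEnergy L M β U μ 0 klE0 (nScales β + 1) (ω, p) 0) (Torus.proj L z)‖ +
          ‖torusFourierInv (fun p : TorusSite 2 L => klSelfEnergy L M β U μ 0 klE0 (nScales β + 1) (ω, p) 0) (Torus.proj L z) - hlim‖ :=
        norm_sub_le_norm_sub_add_norm_sub _ _ _
    _ ≤ ε / 2 + ε / 2 := add_le_add hcut hfin
    _ = ε := by ring

/-- **Termwise (Tannery) ⇒ per-site limits** — BGM Lemma 2.4's proof shape: if beyond a threshold the site-kernel value `h_L(n,z)` is a SERIES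
`Σ' i, a i L` over an `L`-independent index type with an `L`-uniform summable majorant and termwise limits `a i L → a∞ i`, then `h_L(n,z) → Σ' i, a∞ i`
(dominated convergence for series, Mathlib `tendsto_tsum_of_dominated_convergence`). -/
theorem perSite_limit_of_termwise (μ : ℝ) (n : ℤ) (z : Site 2)
    (h : ∃ (ι : Type) (a : ι → ℕ → ℂ) (alim : ι → ℂ) (m : ι → ℝ) (L₀ : ℕ), Summable m ∧ (∀ i, Tendsto (a i) atTop (𝓝 (alim i))) ∧
      (∀ i L, L₀ ≤ L → ‖a i L‖ ≤ m i) ∧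
        ∀ (L : ℕ) [NeZero L], L₀ ≤ L → torusFourierInv (fun p : TorusSite 2 L => klSelfEnergyInf L β U μ 0 n p) (Torus.proj L z) = ∑' i, a i L) :
    ∃ hlim : ℂ, ∀ ε > (0 : ℝ), ∃ L₁ : ℕ, ∀ (L : ℕ) [NeZero L], L₁ ≤ L →
      ‖torusFourierInv (fun p : TorusSite 2 L => klSelfEnergyInf L β U μ 0 n p) (Torus.proj L z) - hlim‖ ≤ ε := by
  obtain ⟨ι, a, alim, m, L₀, hm, hlim, hbd, hrep⟩ := h
  have htan : Tendsto (fun L : ℕ => ∑' i, a i L) atTop (𝓝 (∑' i, alim i)) :=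
    tendsto_tsum_of_dominated_convergence hm hlim (eventually_atTop.2 ⟨L₀, fun L hL i => hbd i L hL⟩)
  refine ⟨∑' i, alim i, fun ε hε => ?_⟩
  obtain ⟨L₂, hL₂⟩ := Metric.tendsto_atTop.1 htan ε hε
  refine ⟨max L₀ L₂, fun L _ hL => ?_⟩
  rw [hrep L ((le_max_left _ _).trans hL), ← dist_eq_norm]
  exact (hL₂ L ((le_max_right _ _).trans hL)).le

end PerSite

/-! ## §2 The doors: a VL child of any generation from per-site / per-label cutoff-free data -/

/-- **A VL child (any `Pr`, `W`) from the CUTOFF-FREE per-label momentum export in ε-form**: for each Matsubara integer `n` and each `ε > 0`, beyond a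
threshold `L₁(n,ε)`, nested same-momentum `ε`-comparability of `klSelfEnergyInf L β U μ 0 n` — no cutoff bookkeeping, no rate function. -/
theorem volumeLimitP2_of_perLabelInfEpsText (Pr : Preds) (W : Set ℝ)
    (hPr : ∀ (R : RenConsts) (U : ℝ) (N : ℕ) (μ : ℝ) (K : TrigPolyC4v), Pr.frameOK R U N μ K → FrameOK R U N μ K)
    (hN : ∀ (G : GeoConsts) (P : SplitConsts) (Q : EngConsts) (R : RenConsts), G.WF → P.WF → Q.WF → R.WF →
      ∃ c₅ : ℝ, 0 < c₅ ∧ ∀ c : ℝ, 0 < c → c ≤ c₅ → ∃ U₀ : ℝ, 0 < U₀ ∧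
        ∀ μ ∈ W, ∀ U : ℝ, 0 < U → U ≤ U₀ → ∀ β : ℝ, klBetaMin ≤ β → β ≤ Real.exp (c / U ^ 2) →
          ∀ K : TrigPolyC4v, Pr.frameOK R U (nScales β) μ K →
            ∀ (Lstar : ℕ) (Mstar : ℕ → ℕ), TowerP Pr G P Q R β U μ K Lstar Mstar →
              ∀ (n : ℤ), ∀ ε > (0 : ℝ), ∃ L₁ : ℕ, ∀ (L : ℕ) [NeZero L], L₁ ≤ L → ∀ (L'' : ℕ) [NeZero L''], L ∣ L'' →
                ∀ (k : TorusSite 2 L) (k'' : TorusSite 2 L''), latticeMomentum L'' k'' = latticeMomentum L k →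
                  ‖klSelfEnergyInf L β U μ 0 n k - klSelfEnergyInf L'' β U μ 0 n k''‖ ≤ ε) :
    VolumeLimitP2 Pr FinalTwoLegVolLimitEx W := by
  refine volumeLimitP2_of_perLabelThresholdsOnlyText Pr W hPr ?_
  intro G P Q R hG hP hQ hR
  obtain ⟨c₅, hc₅, hc⟩ := hN G P Q R hG hP hQ hR
  refine ⟨c₅, hc₅, fun c hc0 hcc => ?_⟩
  obtain ⟨U₀, hU₀, hU⟩ := hc c hc0 hcc
  refine ⟨U₀, hU₀, fun μ hμ U hU0 hUU β hβmin hβmax K hK Lstar Mstar hT n => ?_⟩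
  exact perLabelText_of_nestedInf_eps (pos_of_klBetaMin_le hβmin) hU0.ne' μ n (hU μ hμ U hU0 hUU β hβmin hβmax K hK Lstar Mstar hT n)

/-- **A VL child (any `Pr`, `W`) FROM PER-SITE DATA (ε-form)** — the «termwise» export: for each Matsubara integer `n`, each lattice offset `z ∈ ℤ²` and each
`ε > 0`, beyond a threshold `L₁(n,z,ε)` the site-kernel values `torusFourierInv (Σ∞⁰_L(n,·)) (Torus.proj L z)` are `ε`-comparable across nested volumes
`L ∣ L″`.  One complex sequence at a time; no norm, no uniformity in `n`, `z`, the momentum or the cutoff; no modulus; no rate. -/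
theorem volumeLimitP2_of_perSiteEpsText (Pr : Preds) (W : Set ℝ)
    (hPr : ∀ (R : RenConsts) (U : ℝ) (N : ℕ) (μ : ℝ) (K : TrigPolyC4v), Pr.frameOK R U N μ K → FrameOK R U N μ K)
    (hS : ∀ (G : GeoConsts) (P : SplitConsts) (Q : EngConsts) (R : RenConsts), G.WF → P.WF → Q.WF → R.WF →
      ∃ c₅ : ℝ, 0 < c₅ ∧ ∀ c : ℝ, 0 < c → c ≤ c₅ → ∃ U₀ : ℝ, 0 < U₀ ∧
        ∀ μ ∈ W, ∀ U : ℝ, 0 < U → U ≤ U₀ → ∀ β : ℝ, klBetaMin ≤ β → β ≤ Real.exp (c / U ^ 2) →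
          ∀ K : TrigPolyC4v, Pr.frameOK R U (nScales β) μ K →
            ∀ (Lstar : ℕ) (Mstar : ℕ → ℕ), TowerP Pr G P Q R β U μ K Lstar Mstar →
              ∀ (n : ℤ) (z : Site 2), ∀ ε > (0 : ℝ), ∃ L₁ : ℕ, ∀ (L : ℕ) [NeZero L], L₁ ≤ L → ∀ (L'' : ℕ) [NeZero L''], L ∣ L'' →
                ‖torusFourierInv (fun p : TorusSite 2 L => klSelfEnergyInf L β U μ 0 n p) (Torus.proj L z) -
                    torusFourierInv (fun p : TorusSite 2 L'' => klSelfEnergyInf L'' β U μ 0 n p) (Torus.proj L'' z)‖ ≤ ε) :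
    VolumeLimitP2 Pr FinalTwoLegVolLimitEx W := by
  refine volumeLimitP2_of_perLabelInfEpsText Pr W hPr ?_
  intro G P Q R hG hP hQ hR
  obtain ⟨c₅, hc₅, hc⟩ := hS G P Q R hG hP hQ hR
  refine ⟨c₅, hc₅, fun c hc0 hcc => ?_⟩
  obtain ⟨U₀, hU₀, hU⟩ := hc c hc0 hcc
  refine ⟨U₀, hU₀, fun μ hμ U hU0 hUU β hβmin hβmax K hK Lstar Mstar hT n => ?_⟩
  exact nestedInf_eps_of_perSite_eps (pos_of_klBetaMin_le hβmin) hU0.ne' μ n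
    (fun z => hU μ hμ U hU0 hUU β hβmin hβmax K hK Lstar Mstar hT n z)

/-- **A VL child (any `Pr`, `W`) from per-site nested RATES** (`∀ n z, ∃ L₀ ρ, ρ → 0, ∀ L ≥ L₀, L ∣ L″ ⇒ ‖h_L(n,z) − h_{L″}(n,z)‖ ≤ ρ L`) — the
rate-shaped form of the per-site export (site- and label-dependent thresholds and rates). -/
theorem volumeLimitP2_of_perSiteText (Pr : Preds) (W : Set ℝ)
    (hPr : ∀ (R : RenConsts) (U : ℝ) (N : ℕ) (μ : ℝ) (K : TrigPolyC4v), Pr.frameOK R U N μ K → FrameOK R U N μ K)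
    (hS : ∀ (G : GeoConsts) (P : SplitConsts) (Q : EngConsts) (R : RenConsts), G.WF → P.WF → Q.WF → R.WF →
      ∃ c₅ : ℝ, 0 < c₅ ∧ ∀ c : ℝ, 0 < c → c ≤ c₅ → ∃ U₀ : ℝ, 0 < U₀ ∧
        ∀ μ ∈ W, ∀ U : ℝ, 0 < U → U ≤ U₀ → ∀ β : ℝ, klBetaMin ≤ β → β ≤ Real.exp (c / U ^ 2) →
          ∀ K : TrigPolyC4v, Pr.frameOK R U (nScales β) μ K →
            ∀ (Lstar : ℕ) (Mstar : ℕ → ℕ), TowerP Pr G P Q R β U μ K Lstar Mstar →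
              ∀ (n : ℤ) (z : Site 2), ∃ L₀ : ℕ, ∃ ρ : ℕ → ℝ, Tendsto ρ atTop (𝓝 0) ∧
                ∀ (L : ℕ) [NeZero L], L₀ ≤ L → ∀ (L'' : ℕ) [NeZero L''], L ∣ L'' →
                  ‖torusFourierInv (fun p : TorusSite 2 L => klSelfEnergyInf L β U μ 0 n p) (Torus.proj L z) -
                      torusFourierInv (fun p : TorusSite 2 L'' => klSelfEnergyInf L'' β U μ 0 n p) (Torus.proj L'' z)‖ ≤ ρ L) :
    VolumeLimitP2 Pr FinalTwoLegVolLimitEx W := by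
  refine volumeLimitP2_of_perSiteEpsText Pr W hPr ?_
  intro G P Q R hG hP hQ hR
  obtain ⟨c₅, hc₅, hc⟩ := hS G P Q R hG hP hQ hR
  refine ⟨c₅, hc₅, fun c hc0 hcc => ?_⟩
  obtain ⟨U₀, hU₀, hU⟩ := hc c hc0 hcc
  refine ⟨U₀, hU₀, fun μ hμ U hU0 hUU β hβmin hβmax K hK Lstar Mstar hT n z => ?_⟩
  exact perSite_eps_of_perSite_rate μ n z (hU μ hμ U hU0 hUU β hβmin hβmax K hK Lstar Mstar hT n z)

/-- **A VL child (any `Pr`, `W`) from per-site PLAIN LIMITS** — BGM Lemma 2.4 verbatim: for each Matsubara integer `n` and each lattice offset `z ∈ ℤ²` the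
complex numbers `torusFourierInv (Σ∞⁰_L(n,·)) (Torus.proj L z)` CONVERGE as `L → ∞` (ε-form; any limit, any speed, thresholds depending on `n`, `z`). -/
theorem volumeLimitP2_of_perSiteLimitText (Pr : Preds) (W : Set ℝ)
    (hPr : ∀ (R : RenConsts) (U : ℝ) (N : ℕ) (μ : ℝ) (K : TrigPolyC4v), Pr.frameOK R U N μ K → FrameOK R U N μ K)
    (hS : ∀ (G : GeoConsts) (P : SplitConsts) (Q : EngConsts) (R : RenConsts), G.WF → P.WF → Q.WF → R.WF →
      ∃ c₅ : ℝ, 0 < c₅ ∧ ∀ c : ℝ, 0 < c → c ≤ c₅ → ∃ U₀ : ℝ, 0 < U₀ ∧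
        ∀ μ ∈ W, ∀ U : ℝ, 0 < U → U ≤ U₀ → ∀ β : ℝ, klBetaMin ≤ β → β ≤ Real.exp (c / U ^ 2) →
          ∀ K : TrigPolyC4v, Pr.frameOK R U (nScales β) μ K →
            ∀ (Lstar : ℕ) (Mstar : ℕ → ℕ), TowerP Pr G P Q R β U μ K Lstar Mstar →
              ∀ (n : ℤ) (z : Site 2), ∃ hlim : ℂ, ∀ ε > (0 : ℝ), ∃ L₁ : ℕ, ∀ (L : ℕ) [NeZero L], L₁ ≤ L →
                ‖torusFourierInv (fun p : TorusSite 2 L => klSelfEnergyInf L β U μ 0 n p) (Torus.proj L z) - hlim‖ ≤ ε) :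
    VolumeLimitP2 Pr FinalTwoLegVolLimitEx W := by
  refine volumeLimitP2_of_perSiteEpsText Pr W hPr ?_
  intro G P Q R hG hP hQ hR
  obtain ⟨c₅, hc₅, hc⟩ := hS G P Q R hG hP hQ hR
  refine ⟨c₅, hc₅, fun c hc0 hcc => ?_⟩
  obtain ⟨U₀, hU₀, hU⟩ := hc c hc0 hcc
  refine ⟨U₀, hU₀, fun μ hμ U hU0 hUU β hβmin hβmax K hK Lstar Mstar hT n z => ?_⟩
  exact perSite_eps_of_perSite_limit μ n z (hU μ hμ U hU0 hUU β hβmin hβmax K hK Lstar Mstar hT n z)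

/-- **A VL child (any `Pr`, `W`) from per-site ITERATED FINITE-CUTOFF LIMITS** — the engine's own variables: for each Matsubara integer `n` and offset
`z ∈ ℤ²` there is `h(n,z)` with `∀ ε ∃ L₁ ∀ L ≥ L₁ ∃ M₁ ∀ M ≥ M₁ ∀ ω, matsubaraInt M ω = n →
‖torusFourierInv (Σ̂⁰_{L,M}(ω,·)) (Torus.proj L z) − h(n,z)‖ ≤ ε` (the site kernel of the finite-cutoff bare last-scale self-energy, one label and one
site at a time, cutoff threshold depending on the volume). -/
theorem volumeLimitP2_of_perSiteCutoffLimitText (Pr : Preds) (W : Set ℝ)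
    (hPr : ∀ (R : RenConsts) (U : ℝ) (N : ℕ) (μ : ℝ) (K : TrigPolyC4v), Pr.frameOK R U N μ K → FrameOK R U N μ K)
    (hS : ∀ (G : GeoConsts) (P : SplitConsts) (Q : EngConsts) (R : RenConsts), G.WF → P.WF → Q.WF → R.WF →
      ∃ c₅ : ℝ, 0 < c₅ ∧ ∀ c : ℝ, 0 < c → c ≤ c₅ → ∃ U₀ : ℝ, 0 < U₀ ∧
        ∀ μ ∈ W, ∀ U : ℝ, 0 < U → U ≤ U₀ → ∀ β : ℝ, klBetaMin ≤ β → β ≤ Real.exp (c / U ^ 2) →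
          ∀ K : TrigPolyC4v, Pr.frameOK R U (nScales β) μ K →
            ∀ (Lstar : ℕ) (Mstar : ℕ → ℕ), TowerP Pr G P Q R β U μ K Lstar Mstar →
              ∀ (n : ℤ) (z : Site 2), ∃ hlim : ℂ, ∀ ε > (0 : ℝ), ∃ L₁ : ℕ, ∀ (L : ℕ) [NeZero L], L₁ ≤ L →
                ∃ M₁ : ℕ, ∀ (M : ℕ) [NeZero M], M₁ ≤ M → ∀ ω : MatsubaraIdx M, matsubaraInt M ω = n →
                  ‖torusFourierInv (fun p : TorusSite 2 L => klSelfEnergy L M β U μ 0 klE0 (nScales β + 1) (ω, p) 0) (Torus.proj L z) - hlim‖ ≤ ε) :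
    VolumeLimitP2 Pr FinalTwoLegVolLimitEx W := by
  refine volumeLimitP2_of_perSiteLimitText Pr W hPr ?_
  intro G P Q R hG hP hQ hR
  obtain ⟨c₅, hc₅, hc⟩ := hS G P Q R hG hP hQ hR
  refine ⟨c₅, hc₅, fun c hc0 hcc => ?_⟩
  obtain ⟨U₀, hU₀, hU⟩ := hc c hc0 hcc
  refine ⟨U₀, hU₀, fun μ hμ U hU0 hUU β hβmin hβmax K hK Lstar Mstar hT n z => ?_⟩
  exact perSite_limit_of_perSite_cutoffLimit (pos_of_klBetaMin_le hβmin) μ n z (hU μ hμ U hU0 hUU β hβmin hβmax K hK Lstar Mstar hT n z)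

/-- **A VL child (any `Pr`, `W`) from a TERMWISE expansion of the per-site values** — BGM Lemma 2.4's proof shape as an export: for each `n` and `z`,
beyond a threshold, `h_L(n,z) = Σ' i, a i L` over an `L`-independent index type, with an `L`-uniform summable majorant and termwise limits. -/
theorem volumeLimitP2_of_perSiteTermwiseText (Pr : Preds) (W : Set ℝ)
    (hPr : ∀ (R : RenConsts) (U : ℝ) (N : ℕ) (μ : ℝ) (K : TrigPolyC4v), Pr.frameOK R U N μ K → FrameOK R U N μ K)
    (hS : ∀ (G : GeoConsts) (P : SplitConsts) (Q : EngConsts) (R : RenConsts), G.WF → P.WF → Q.WF → R.WF →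
      ∃ c₅ : ℝ, 0 < c₅ ∧ ∀ c : ℝ, 0 < c → c ≤ c₅ → ∃ U₀ : ℝ, 0 < U₀ ∧
        ∀ μ ∈ W, ∀ U : ℝ, 0 < U → U ≤ U₀ → ∀ β : ℝ, klBetaMin ≤ β → β ≤ Real.exp (c / U ^ 2) →
          ∀ K : TrigPolyC4v, Pr.frameOK R U (nScales β) μ K →
            ∀ (Lstar : ℕ) (Mstar : ℕ → ℕ), TowerP Pr G P Q R β U μ K Lstar Mstar →
              ∀ (n : ℤ) (z : Site 2), ∃ (ι : Type) (a : ι → ℕ → ℂ) (alim : ι → ℂ) (m : ι → ℝ) (L₀ : ℕ),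
                Summable m ∧ (∀ i, Tendsto (a i) atTop (𝓝 (alim i))) ∧ (∀ i L, L₀ ≤ L → ‖a i L‖ ≤ m i) ∧
                  ∀ (L : ℕ) [NeZero L], L₀ ≤ L →
                    torusFourierInv (fun p : TorusSite 2 L => klSelfEnergyInf L β U μ 0 n p) (Torus.proj L z) = ∑' i, a i L) :
    VolumeLimitP2 Pr FinalTwoLegVolLimitEx W := by
  refine volumeLimitP2_of_perSiteLimitText Pr W hPr ?_
  intro G P Q R hG hP hQ hR
  obtain ⟨c₅, hc₅, hc⟩ := hS G P Q R hG hP hQ hR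
  refine ⟨c₅, hc₅, fun c hc0 hcc => ?_⟩
  obtain ⟨U₀, hU₀, hU⟩ := hc c hc0 hcc
  refine ⟨U₀, hU₀, fun μ hμ U hU0 hUU β hβmin hβmax K hK Lstar Mstar hT n z => ?_⟩
  exact perSite_limit_of_termwise μ n z (hU μ hμ U hU0 hUU β hβmin hβmax K hK Lstar Mstar hT n z)

end Summit.HubbardSuperconductivity.HubbardSuperconductivity.Theorems.TwoPointAssembly

end
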